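import Summits.ResolutionOfSingularities.ResolutionOfSingularities.Theorems.MarkedTransferCampaignW31UscInvOneExponent
import Literature.AlgebraicGeometry.Hironaka2017.S06BaseHike.R010eRegularCut
import HarnessLib

/-!
# [OURS · L1 W3.1] The ⟨RegularCut⟩ premise of GAP-LEDGER R12/12a DECOMPOSED over the W3.1 vocabulary:
# «`Σ_max` closed in `Sing(Ê)_cl`» (slot W3.1, u.s.c. of `Inv`) ∧ «`Σ̄_max` REGULAR» (the open G3 residual of record) —
# campaign STATEMENTS `CampaignW31.HatStratumClosed` / `HatClosureRegular` / `HatOrdPowCut` (+ `…I p` slices) and the generic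
# devices `StratumRelClosedOn` / `invmaxClosure` / `InvmaxClosureRegularOn` / `RegularCutOn` / `OrdPowAlong` / `OrdPowCutOn`

Cell `res-hironaka` (run/shared/lean/pub/res-hironaka/), rung L (rescue) of LADDER-RESOLUTION, slot W3.1 «u.s.c. first»
(positive rung, verdict-free); third file of the slot, companion of `Theorems/MarkedTransferCampaignW31UscInvOneExponent.lean`
(p463247: slot statement `CampaignW31UscInvOneExponentI p`, consequences `CampaignW31InvmaxClosedI p`) and
`Theorems/MarkedTransferCampaignW31EdgeHilbertLsc.lean` (p464862). Typed by the OURS typer o4 (statement-only lane). HOST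
(custody, no new route): the EXISTING crux `Theses.MarkedTransfer.HypersurfaceOrderReduction` (stmt-ResolutionOfSingularities-16155),
`--kind definition --supports`, as the two earlier W3.1 files.

WHY (records on the cell's STATUS.md / INBOX.md): the lead of adjudication group 3 (res-adj-3) entered GAP-LEDGER R12/12a —
EXISTENCE of the core focusing `Ě` of Eq. (43) p.30 l.4–9, for which the manuscript prints no argument — as
FOLLOWS-MODULO-⟨RegularCut⟩ BY OURS ARGUMENT (2026-08-26T21:10:17Z / 21:46:09Z; kernel witness: res-type-010's cut-down
`(J ⊔ 𝓘_C^d, d)`, `Lib/CoreFocusCutDown.lean` p470790; discharge-lane consumer `S06BaseHike.U30_2_R2_inst_of_regularCut` p473407);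
the premise is typed (OURS, not printed) as `S06BaseHike.RegularCut_ours IsEdgeData A n` (R010eRegularCut.lean p472988): «for
every standard `E` and every certified edge-data family on `Sing(Ê)_cl`, SOME regular closed `C ⊆ Z` cuts the `Inv_max`-stratum
`Σ_max` out of `Sing(Ê)_cl` and lies in `Σ̄_max`». Director's ruling 2026-08-26T21:27:42Z (3): «S-s31 consumes R12 via 12a
(RegularCut ⇐ W3.1 u.s.c. ∧ Σ̄_max regular) … open G3 residual of record = RegularCut's regularity half (no seat, no printed
argument; named binder for the D-lane)»; res-D-plan-2 NEEDS-DECL 22:33:10Z asks for that binder BY NAME. This file supplies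
exactly that decomposition, as kernel facts of pure topology over OUR typed carriers:
* `CampaignW31.regularCutOn_iff`: for ANY point set `S` and value function `f`,
  `RegularCutOn S f ↔ StratumRelClosedOn S f ∧ InvmaxClosureRegularOn S f` — a closed `C` with `C ∩ S = Σ_max`, `C ⊆ Σ̄_max`
  IS `Σ̄_max` (`eq_invmaxClosure_of_cut`). Hence, binder for binder,
* `CampaignW31.regularCut_ours_iff`: `RegularCut_ours IsEdgeData A n ↔ HatStratumClosed IsEdgeData A n ∧ HatClosureRegular IsEdgeData A n`.
  The CLOSEDNESS HALF is slot W3.1's delivery: for every `Ê` with `0 < Ê.b` it follows from the slot file's `CampaignW31InvmaxClosed`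
  (`hatStratumClosed_of_invmaxClosed`; the W3.1 selection idiom and row 010d's family idiom agree on the nose, `selInv_eq_invField`).
  The REGULARITY HALF «`Σ̄_max(Ê)` regular» is the open residual, now ONE named `Prop` (slice `CampaignW31HatClosureRegularI p`)
  that discharge-lane consumers can bind instead of the whole `RegularCut_ours`.
* The WEAKER door recorded by res-type-010 (STATUS 2026-08-26T21:13:46Z (1), informal): regularity of the cut enters the cut-down
  argument ONLY through «an ideal sheaf of order `≥ μ` along `C` lies in `𝓘_C^μ`» (tree `le_vanishingIdeal_pow_of_forall_le_idealOrder`,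
  [CoP1] Prop. 4.2, ordinary = symbolic powers for a regular centre) — typed BY NAME as `OrdPowAlong C`, with `OrdPowCutOn S f`,
  `ordPowCutOn_iff`, `HatOrdPowCut`; whether it is a RESCUE-SEED variant is res-plan-2's call (no slot is claimed here).

HONEST FRAMING. Every declaration below is OURS (a campaign statement about OUR typed objects) or pure logic / point-set
topology; NOTHING here is a statement of H. Hironaka's manuscript *Resolution of singularities in positive characteristics*
(2017-03-23, [Hironaka2017], lit key `paper:url-3343fd9e678b`) and nothing here asserts that any statement of that manuscript
holds. p.30 l.4–9 (layout L3–L8) reads: «Let Inv_max(Ê) denote the lexicographical maximum of Inv_ξ(Ê) for all ξ ∈ Sing(Ê)_cl.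
We then have an ideal exponent Ě naturally associated with Ê such that (43) ℘(Ě) ⊃ ℘(Ê) and Sing(Ě)_cl = {ξ ∈ Sing(Ê)_cl |
Inv_ξ(Ê) = Inv_max(Ê)} where ℘(Ě) is the maximum under these conditions» — quoted for scope only; no regularity of the closure of
that stratum is printed anywhere, and none is asserted here: `HatClosureRegular` / `InvmaxClosureRegularOn` / `HatOrdPowCut` are
CANDIDATE premises whose truth value is what group 3 has to find out (kill test K3.2′ records the regularity of the separating
stratum's closure at the origin on its two witnesses, director 21:27:42Z (3)).

## Vacuity self-check (T-lint; for the lanes)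
* `HatClosureRegular` / `InvmaxClosureRegularOn`: NOT trivially true — regularity of the reduced closed subscheme on `Σ̄_max` is a
  genuine condition once `Σ_max` is positive-dimensional (for a FINITE `Σ_max` of closed points over a perfect field it holds, the
  situation of the K3.1/K3.2 witnesses where `Σ_max = {O}`, res-L1-k31 `invmaxStratum_eq_singleton_origin`); NOT trivially false.
  Vacuous exactly where `RegularCut_ours` is: at an `E` whose closed singular points carry no certified edge data — disclosed on
  R010e and on the slot file rev. 2 alike. CANDIDATE WARNING (typer's reading, NOT a verdict, uncertified): nothing on record
  excludes a standard `E` whose `Inv` is CONSTANT along a singular curve `Γ = Sing(E)` (then `Σ̄_max = Γ` and `HatClosureRegular`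
  fails at `E`); a test specimen is proposed to the G3 lead on STATUS together with this file, not asserted here.
* `StratumRelClosedOn` / `HatStratumClosed`: non-vacuous consequences of u.s.c.; for `0 < Ê.b` they FOLLOW from
  `CampaignW31InvmaxClosed` (anchors below), itself assembled from the slot statement by res-L1-k31 (p467881).
* `OrdPowAlong C`: non-vacuous (fails for the three coordinate axes in 𝔸³ — `xyz` has order `≥ 2` along them and is not in the
  square of their ideal; classical, not used here) and holds for regular `C` in regular `Z` (tree lemma).

## References (context; nothing below is used as a premise)
* H. Hironaka, ms. 2017-03-23, §6.2 p.30 l.4–9, Eq. (43) — quoted for scope only, under adjudication. [Hironaka2017]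
* V. Cossart, O. Piltant, J. Algebra 320 (2008), Prop. 4.2 (regular-centre lemma; tree `PermissibleLSB.lean`). [CossartPiltant2008]
* Cell records: res-adj-3 R12/12a (STATUS 2026-08-26T21:10:17Z, 21:46:09Z); director-resolution 21:27:42Z (3); res-D-plan-2
  NEEDS-DECL 22:33:10Z; res-type-010 R010e p472988 / Lib/CoreFocusCutDown p470790 / NOTE 21:13:46Z (1).
-/

noncomputable section

set_option linter.dupNamespace false -- mandated namespace of this single-conjunct summit

open _root_.AlgebraicGeometry _root_.TopologicalSpace

namespace Summit.ResolutionOfSingularities.ResolutionOfSingularities.Theorems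

open Literature.AlgebraicGeometry.Resolution
open Literature.AlgebraicGeometry.Hironaka2017
open Literature.AlgebraicGeometry.Hironaka2017.S02Preliminaries
open Literature.AlgebraicGeometry.Hironaka2017.S04CharAlgebra
open Literature.AlgebraicGeometry.Hironaka2017.S06BaseHike
open Literature.AlgebraicGeometry.Hironaka2017.Datum

universe u

namespace CampaignW31

/-! ## Generic devices: the `Inv_max`-stratum, its closure, the two halves of ⟨RegularCut⟩, the weaker door -/

section Generic

variable {Z : Scheme.{u}} {n : ℕ}

/-- [OURS · L1 W3.1] replaces the role of the presupposition of Eq. (43) p.30 l.8 that the `Inv_max`-stratum is a closed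
singular locus; NOT a statement of the manuscript. Generic form of the slot file's `CampaignW31.InvmaxStratumClosed`:
for a point set `S ⊆ Z` and a value function `f : Z → EdgeInv n`, the `Inv_max`-stratum `invmaxStratum S f` (row 007a:
the points of `S` where `f` is maximal on `S`) is the trace on `S` of a CLOSED subset of `Z`. [folklore] -/
def StratumRelClosedOn (S : Set Z) (f : Z → EdgeInv n) : Prop :=
  ∃ C : Set Z, IsClosed C ∧ invmaxStratum S f = C ∩ S

/-- [OURS · L1 W3.1] plumbing (REAL definition; replaces the role of the symbol «Σ̄_max», the closure of the stratum of
Eq. (43) p.30 l.8, which the manuscript does not form): the closure in `Z` of the `Inv_max`-stratum `invmaxStratum S f`, as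
a closed subset of `Z` (Mathlib `TopologicalSpace.Closeds.closure`). NOT a statement of the manuscript. [folklore] -/
def invmaxClosure (S : Set Z) (f : Z → EdgeInv n) : Closeds Z :=
  Closeds.closure (invmaxStratum S f)

/-- [OURS · L1 W3.1] THE REGULARITY HALF of ⟨RegularCut⟩ — replaces the role of NOTHING printed (the manuscript prints
no argument for the existence of `Ě`, p.30 l.4–9, and never mentions the closure of the `Inv_max`-stratum); it is the
«open G3 residual of record» of the director's ruling 2026-08-26T21:27:42Z (3). Generic form: the closure `Σ̄_max` of
`invmaxStratum S f`, with its REDUCED closed-subscheme structure (`(vanishingIdeal Σ̄_max).subscheme`, Mathlib), is a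
regular scheme (`Resolution.Scheme.IsRegular`: all stalks regular local rings). CANDIDATE premise; NOT a statement of the
manuscript; no argument either way is on record. [folklore] -/
def InvmaxClosureRegularOn (S : Set Z) (f : Z → EdgeInv n) : Prop :=
  Scheme.IsRegular (Scheme.IdealSheafData.vanishingIdeal (invmaxClosure S f)).subscheme

/-- [OURS · L1 W3.1] generic ⟨RegularCut⟩ — replaces the role of nothing printed; it is, LITERALLY, the inner body of
the OURS premise `S06BaseHike.RegularCut_ours` (R010eRegularCut.lean p472988, res-adj-3's R12/12a MODULO premise) and of
the binder `hcut` of `Lib/CoreFocusCutDown.exists_isCoreFocus_ambient` (p470790), generic in the point set `S` and the value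
function `f`: SOME closed `C ⊆ Z` with regular reduced structure cuts the `Inv_max`-stratum out of `S` (`C ∩ S = Σ_max`)
and lies in its closure (`C ⊆ Σ̄_max`). By `regularCutOn_iff` such a `C` is necessarily `Σ̄_max`. NOT a statement of the
manuscript. [folklore] -/
def RegularCutOn (S : Set Z) (f : Z → EdgeInv n) : Prop :=
  ∃ C : Closeds Z, Scheme.IsRegular (Scheme.IdealSheafData.vanishingIdeal C).subscheme ∧
    (C : Set Z) ∩ S = invmaxStratum S f ∧ (C : Set Z) ⊆ closure (invmaxStratum S f)

/-- [OURS · L1 W3.1] replaces the role of nothing printed — the property of a closed `C ⊆ Z` that the cut-down argument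
for Eq. (43) p.30 actually CONSUMES of «`C` regular» (res-type-010, `Lib/CoreFocusCutDown.pAlg_le_cutDown`; informal NOTE
STATUS 2026-08-26T21:13:46Z (1)): every ideal sheaf `J` whose order is `≥ μ` at every point of `C` lies in the `μ`-th
power of the (radical) ideal sheaf `𝓘_C` of `C` — i.e. «ordinary powers of `𝓘_C` = the order-defined (symbolic /
differential) powers». For `C` regular in a regular locally Noetherian `Z` this is the tree lemma
`Hironaka2017.le_vanishingIdeal_pow_of_forall_le_idealOrder` ([CoP1] Prop. 4.2); in general it is a genuine condition on the
singularities of `C`. Typed BY NAME so that a weaker MODULO premise than ⟨RegularCut⟩ can be cited; no slot is claimed.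
NOT a statement of the manuscript. [folklore] -/
def OrdPowAlong (C : Closeds Z) : Prop :=
  ∀ ⦃J : Z.IdealSheafData⦄ ⦃μ : ℕ⦄, (∀ y ∈ (C : Set Z), (μ : ℕ∞) ≤ idealOrder J y) →
    J ≤ Scheme.IdealSheafData.vanishingIdeal C ^ μ

/-- [OURS · L1 W3.1] the WEAKER DOOR in the shape of ⟨RegularCut⟩ — replaces the role of nothing printed: SOME closed
`C ⊆ Z` with `OrdPowAlong C` cuts the `Inv_max`-stratum out of `S` and lies in its closure (then `C = Σ̄_max`,
`ordPowCutOn_iff`). NOT a statement of the manuscript; whether it is a RESCUE-SEED variant is res-plan-2's call. [folklore] -/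
def OrdPowCutOn (S : Set Z) (f : Z → EdgeInv n) : Prop :=
  ∃ C : Closeds Z, OrdPowAlong C ∧
    (C : Set Z) ∩ S = invmaxStratum S f ∧ (C : Set Z) ⊆ closure (invmaxStratum S f)

/-- Pure logic: the `Inv_max`-stratum of `S` lies in `S` (row 007a's definition). [folklore] -/
theorem invmaxStratum_subset (S : Set Z) (f : Z → EdgeInv n) : invmaxStratum S f ⊆ S :=
  fun _ h => h.1

/-- Pure topology: a CLOSED `C` with `C ∩ S = Σ_max` and `C ⊆ Σ̄_max` IS `Σ̄_max` — the cut of ⟨RegularCut⟩ is unique.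
[folklore] -/
theorem eq_invmaxClosure_of_cut {S : Set Z} {f : Z → EdgeInv n} {C : Closeds Z}
    (hC : (C : Set Z) ∩ S = invmaxStratum S f) (hCcl : (C : Set Z) ⊆ closure (invmaxStratum S f)) :
    C = invmaxClosure S f := by
  refine Closeds.ext (Set.Subset.antisymm hCcl ?_)
  have hSC : invmaxStratum S f ⊆ (C : Set Z) := fun x hx => (hC.symm ▸ hx : x ∈ (C : Set Z) ∩ S).1
  exact C.isClosed.closure_subset_iff.mpr hSC

/-- Pure topology: if `Σ_max` is the trace on `S` of a closed set, then it is the trace of its own closure: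
`Σ̄_max ∩ S = Σ_max`. [folklore] -/
theorem invmaxClosure_inter_eq {S : Set Z} {f : Z → EdgeInv n} (h : StratumRelClosedOn S f) :
    (invmaxClosure S f : Set Z) ∩ S = invmaxStratum S f := by
  obtain ⟨C, hC, hS⟩ := h
  refine Set.Subset.antisymm ?_ fun x hx => ⟨subset_closure hx, invmaxStratum_subset S f hx⟩
  have hcl : closure (invmaxStratum S f) ⊆ C :=
    hC.closure_subset_iff.mpr fun x hx => (hS ▸ hx : x ∈ C ∩ S).1
  intro x hx
  rw [hS]
  exact ⟨hcl hx.1, hx.2⟩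

/-- **Pure topology — THE DECOMPOSITION**: ⟨RegularCut⟩ for `(S, f)` holds iff the `Inv_max`-stratum is the trace on `S`
of a closed set AND its closure `Σ̄_max` (reduced structure) is regular. (`→`: the cut is `Σ̄_max` by
`eq_invmaxClosure_of_cut`; `←`: take `C := Σ̄_max`, a cut by `invmaxClosure_inter_eq`.) [folklore] -/
theorem regularCutOn_iff (S : Set Z) (f : Z → EdgeInv n) :
    RegularCutOn S f ↔ StratumRelClosedOn S f ∧ InvmaxClosureRegularOn S f := by
  constructor
  · rintro ⟨C, hreg, hC, hCcl⟩
    refine ⟨⟨(C : Set Z), C.isClosed, hC.symm⟩, ?_⟩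
    have hCeq : C = invmaxClosure S f := eq_invmaxClosure_of_cut hC hCcl
    subst hCeq
    exact hreg
  · rintro ⟨hcl, hreg⟩
    exact ⟨invmaxClosure S f, hreg, invmaxClosure_inter_eq hcl, subset_rfl⟩

/-- Pure topology, same argument for the weaker door: `OrdPowCutOn S f ↔ StratumRelClosedOn S f ∧ OrdPowAlong Σ̄_max`.
[folklore] -/
theorem ordPowCutOn_iff (S : Set Z) (f : Z → EdgeInv n) :
    OrdPowCutOn S f ↔ StratumRelClosedOn S f ∧ OrdPowAlong (invmaxClosure S f) := by
  constructor
  · rintro ⟨C, hpow, hC, hCcl⟩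
    refine ⟨⟨(C : Set Z), C.isClosed, hC.symm⟩, ?_⟩
    have hCeq : C = invmaxClosure S f := eq_invmaxClosure_of_cut hC hCcl
    subst hCeq
    exact hpow
  · rintro ⟨hcl, hpow⟩
    exact ⟨invmaxClosure S f, hpow, invmaxClosure_inter_eq hcl, subset_rfl⟩

end Generic

/-! ## The two typed idioms for «edge data chosen on `Sing(E)_cl`» agree on the nose -/

section Idioms

variable {Z : Scheme.{u}} {p n : ℕ} {E : IdealExponent Z}
  {IsEdgeData : ∀ ⦃X : Scheme.{u}⦄ ⦃p n : ℕ⦄ (E : IdealExponent X) (ξ : X), EdgeDatumAt p n E ξ → Prop}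

/-- [OURS · L1 W3.1] plumbing (REAL definition; replaces nothing printed): a CERTIFIED family of edge data on `Sing(E)_cl`
in row 010d's idiom (`ed : EdgeDataOn p n E`, `hed : IsEdgeDataOn IsEdgeData E ed`, R010dECheckInst.lean p465365) packaged
as a W3.1 edge-data selection (slot file's `CampaignW31.EdgeDataSelection`). The two carriers have the same fields; this
and `selInv_eq_invField` let statements typed in either idiom be cited from the other without a translation argument.
NOT a statement of the manuscript. [folklore] -/
def EdgeDataSelection.ofFamily (ed : EdgeDataOn p n E) (hed : IsEdgeDataOn IsEdgeData E ed) :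
    EdgeDataSelection p n E IsEdgeData :=
  ⟨ed, hed⟩

/-- Pure logic: the family underlying `EdgeDataSelection.ofFamily ed hed` is `ed`. [folklore] -/
theorem EdgeDataSelection.ofFamily_D (ed : EdgeDataOn p n E) (hed : IsEdgeDataOn IsEdgeData E ed) :
    (EdgeDataSelection.ofFamily ed hed).D = ed :=
  rfl

/-- Pure logic: the provenance of a W3.1 selection, in row 010d's spelling. [folklore] -/
theorem EdgeDataSelection.isEdgeDataOn (sel : EdgeDataSelection p n E IsEdgeData) :
    IsEdgeDataOn IsEdgeData E sel.D :=
  sel.isEdgeData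

/-- Pure logic (definitional unfolding): the value function `ξ ↦ Inv_ξ(E)` READ OFF a W3.1 selection (`CampaignW31.selInv`,
slot file) IS row 010d's `invField E sel.D` — same value `S04CharAlgebra.inv (sel.D ξ _)` on `Sing(E)_cl` (Eq. (34)), same
filler `(n, n, ∅)` off it. [folklore] -/
theorem selInv_eq_invField [Fact p.Prime] (sel : EdgeDataSelection p n E IsEdgeData) :
    selInv sel = invField E sel.D := by
  funext ξ
  unfold selInv invField
  split_ifs <;> rfl

/-- Pure logic (`Iff.rfl`): the slot file's `CampaignW31.InvmaxStratumClosed sel` is the generic `StratumRelClosedOn` at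
`S := Sing(E)_cl`, `f := selInv sel`. [folklore] -/
theorem invmaxStratumClosed_iff [Fact p.Prime] (sel : EdgeDataSelection p n E IsEdgeData) :
    InvmaxStratumClosed sel ↔ StratumRelClosedOn (E.sing ∩ S02Preliminaries.closedPoints Z) (selInv sel) :=
  Iff.rfl

end Idioms

/-! ## Campaign statements in the binder shape of `S06BaseHike.RegularCut_ours` (every standard `E`, every certified
family of edge data on `Sing(Ê)_cl`, `Ê = baseHike E`) -/

section Hat

variable (IsEdgeData : ∀ ⦃X : Scheme.{u}⦄ ⦃p n : ℕ⦄ (E : IdealExponent X) (ξ : X), EdgeDatumAt p n E ξ → Prop)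

/-- **[OURS · L1 W3.1] `CampaignW31.HatStratumClosed` — THE CLOSEDNESS HALF of ⟨RegularCut⟩** (what slot W3.1 delivers
towards R12/12a): replaces the role of the presupposition of Eq. (43) p.30 l.8 that «{ξ ∈ Sing(Ê)_cl | Inv_ξ(Ê) = Inv_max(Ê)}»
is the closed singular locus of an ideal exponent; NOT a statement of the manuscript. Same binders as
`S06BaseHike.RegularCut_ours IsEdgeData A n`: for every standard `E` on `A.Z` and every certified edge-data family `ed` on
`Sing(Ê)_cl` (`Ê = baseHike E`, row 009; `EdgeDataOn` / `IsEdgeDataOn` / `invField`, row 010d), the `Inv_max`-stratum of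
`ξ ↦ Inv_ξ(Ê)` is the trace on `Sing(Ê)_cl` of a closed subset of `A.Z`. For `0 < Ê.b` it FOLLOWS from the slot file's
`CampaignW31InvmaxClosed IsEdgeData` (`hatStratumClosed_of_invmaxClosed`). [folklore] -/
def HatStratumClosed {p : ℕ} [Fact p.Prime] {K : Type u} [Field K] [CharP K p] [PerfectField K] (A : AmbientDatum p K)
    (n : ℕ) : Prop :=
  ∀ (E : IdealExponent A.Z) (ed : EdgeDataOn p n (baseHike E)), E.IsStandard →
    IsEdgeDataOn IsEdgeData (baseHike E) ed →
      StratumRelClosedOn ((baseHike E).sing ∩ S02Preliminaries.closedPoints A.Z) (invField (baseHike E) ed)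

/-- **[OURS · L1 W3.1] `CampaignW31.HatClosureRegular` — THE REGULARITY HALF of ⟨RegularCut⟩, the open G3 residual of
record** (director 2026-08-26T21:27:42Z (3): «RegularCut's regularity half (no seat, no printed argument; named binder for
the D-lane)»): replaces the role of NOTHING printed (no argument for the existence of `Ě`, p.30 l.4–9, is printed); NOT a
statement of the manuscript. Same binders as `S06BaseHike.RegularCut_ours IsEdgeData A n`: for every standard `E` on `A.Z`
and every certified edge-data family `ed` on `Sing(Ê)_cl`, the closure `Σ̄_max(Ê)` of the `Inv_max`-stratum of
`ξ ↦ Inv_ξ(Ê)`, with its reduced closed-subscheme structure, is REGULAR (`CampaignW31.InvmaxClosureRegularOn`). CANDIDATE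
premise: no argument either way is on record; see the module docstring's candidate warning. Together with
`HatStratumClosed` it is EQUIVALENT to `RegularCut_ours` (`regularCut_ours_iff`). [folklore] -/
def HatClosureRegular {p : ℕ} [Fact p.Prime] {K : Type u} [Field K] [CharP K p] [PerfectField K] (A : AmbientDatum p K)
    (n : ℕ) : Prop :=
  ∀ (E : IdealExponent A.Z) (ed : EdgeDataOn p n (baseHike E)), E.IsStandard →
    IsEdgeDataOn IsEdgeData (baseHike E) ed →
      InvmaxClosureRegularOn ((baseHike E).sing ∩ S02Preliminaries.closedPoints A.Z) (invField (baseHike E) ed)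

/-- **[OURS · L1 W3.1] `CampaignW31.HatOrdPowCut` — the WEAKER DOOR in the binder shape of `RegularCut_ours`**: replaces
the role of nothing printed; NOT a statement of the manuscript. For every standard `E` and every certified family `ed` on
`Sing(Ê)_cl`: SOME closed `C ⊆ A.Z` with `CampaignW31.OrdPowAlong C` (ideal sheaves of order `≥ μ` along `C` lie in
`𝓘_C^μ`) cuts the `Inv_max`-stratum of `ξ ↦ Inv_ξ(Ê)` out of `Sing(Ê)_cl` and lies in its closure. Implied by
`RegularCut_ours` on the manuscript's ambient datum via the tree lemma `le_vanishingIdeal_pow_of_forall_le_idealOrder`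
(not derived in this statement-only file); res-type-010's NOTE 2026-08-26T21:13:46Z (1) records that the cut-down witness of
R12/12a needs only this. CANDIDATE premise; no slot claimed. [folklore] -/
def HatOrdPowCut {p : ℕ} [Fact p.Prime] {K : Type u} [Field K] [CharP K p] [PerfectField K] (A : AmbientDatum p K)
    (n : ℕ) : Prop :=
  ∀ (E : IdealExponent A.Z) (ed : EdgeDataOn p n (baseHike E)), E.IsStandard →
    IsEdgeDataOn IsEdgeData (baseHike E) ed →
      OrdPowCutOn ((baseHike E).sing ∩ S02Preliminaries.closedPoints A.Z) (invField (baseHike E) ed)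

/-- **Pure logic — `RegularCut_ours` DECOMPOSED**: res-adj-3's R12/12a premise (as typed by res-type-010, R010e p472988) is
EQUIVALENT to the conjunction of the closedness half (slot W3.1) and the regularity half (the open residual), binder for
binder; by `regularCutOn_iff` at each `(E, ed)`. [folklore] -/
theorem regularCut_ours_iff {p : ℕ} [Fact p.Prime] {K : Type u} [Field K] [CharP K p] [PerfectField K]
    (A : AmbientDatum p K) (n : ℕ) :
    RegularCut_ours IsEdgeData A n ↔ HatStratumClosed IsEdgeData A n ∧ HatClosureRegular IsEdgeData A n := by
  constructor
  · intro h
    exact ⟨fun E ed hE hed => ((regularCutOn_iff _ _).mp (h E ed hE hed)).1,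
      fun E ed hE hed => ((regularCutOn_iff _ _).mp (h E ed hE hed)).2⟩
  · rintro ⟨h₁, h₂⟩ E ed hE hed
    exact (regularCutOn_iff _ _).mpr ⟨h₁ E ed hE hed, h₂ E ed hE hed⟩

/-- Pure logic, the direction consumers use: the two halves give `RegularCut_ours` (hence, through
`S06BaseHike.U30_2_R2_inst_of_regularCut` p473407, the existence of `Ě` in the typed sense `U30_2_R2_inst`). [folklore] -/
theorem regularCut_ours_of_halves {p : ℕ} [Fact p.Prime] {K : Type u} [Field K] [CharP K p] [PerfectField K]
    (A : AmbientDatum p K) (n : ℕ) (h₁ : HatStratumClosed IsEdgeData A n) (h₂ : HatClosureRegular IsEdgeData A n) :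
    RegularCut_ours IsEdgeData A n :=
  (regularCut_ours_iff IsEdgeData A n).mpr ⟨h₁, h₂⟩

/-- Pure logic: `Ê = baseHike E` has the ideal of `E` (row 009), so it is standard once its exponent is positive. [folklore] -/
theorem isStandard_baseHike {Z : Scheme.{u}} {E : IdealExponent Z} (hE : E.IsStandard) (hb : 0 < (baseHike E).b) :
    (baseHike E).IsStandard :=
  ⟨hE.1, hb⟩

/-- **Pure logic — THE CLOSEDNESS HALF FROM SLOT W3.1**: the slot file's consequence statement
`CampaignW31InvmaxClosed IsEdgeData` (p461513/p463247: `Inv_max` attained and the `Inv_max`-stratum closed in `Sing(E)_cl`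
for EVERY standard `E` and every selection) yields `HatStratumClosed` at every `Ê = baseHike E` with `0 < Ê.b` — the guard of
`S06BaseHike.U30_2_R2_inst` (row 010d), which excludes exactly row 009's junk value `Ê = (J, 0)`. The selection is
`EdgeDataSelection.ofFamily ed hed`; the value functions agree by `selInv_eq_invField`. [folklore] -/
theorem hatStratumClosed_of_invmaxClosed (h : CampaignW31InvmaxClosed.{u} IsEdgeData)
    {p : ℕ} [Fact p.Prime] (K : Type u) [Field K] [CharP K p] [PerfectField K] (A : AmbientDatum p K) (n : ℕ)
    (E : IdealExponent A.Z) (ed : EdgeDataOn p n (baseHike E)) (hE : E.IsStandard) (hb : 0 < (baseHike E).b)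
    (hed : IsEdgeDataOn IsEdgeData (baseHike E) ed) :
    StratumRelClosedOn ((baseHike E).sing ∩ S02Preliminaries.closedPoints A.Z) (invField (baseHike E) ed) := by
  have h' := (h p K A n (baseHike E) (isStandard_baseHike hE hb) (EdgeDataSelection.ofFamily ed hed)).2
  rwa [invmaxStratumClosed_iff, selInv_eq_invField, EdgeDataSelection.ofFamily_D] at h'

end Hat

end CampaignW31

open CampaignW31

/-! ## Per-`p` slices at row 005 part b's provenance (parameter-free targets; pattern of the slot file rev. 2) -/

/-- **[OURS · L1 W3.1] `CampaignW31HatStratumClosedI p`** — `p`-slice of the CLOSEDNESS HALF `CampaignW31.HatStratumClosed`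
INSTANTIATED with row 005 part b's Def. 4.9 provenance (`CampaignW31.edgeDataProvenance`): for every perfect `K` of
characteristic `p`, ambient datum `A`, `n`, standard `E` on `A.Z` and certified edge-data family on `Sing(Ê)_cl`, the
`Inv_max`-stratum of `ξ ↦ Inv_ξ(Ê)` is the trace on `Sing(Ê)_cl` of a closed set. Replaces the role of the presupposition of
Eq. (43) p.30 l.8; NOT a statement of the manuscript. [folklore] -/
def CampaignW31HatStratumClosedI (p : ℕ) [Fact p.Prime] : Prop :=
  ∀ (K : Type u) [Field K] [CharP K p] [PerfectField K] (A : AmbientDatum p K) (n : ℕ),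
    HatStratumClosed CampaignW31.edgeDataProvenance A n

/-- **[OURS · L1 W3.1] `CampaignW31HatClosureRegularI p` — THE NAMED RESIDUAL, `p`-slice**: the REGULARITY HALF
`CampaignW31.HatClosureRegular` INSTANTIATED with row 005 part b's provenance (`CampaignW31.edgeDataProvenance`): for every
perfect `K` of characteristic `p`, ambient datum `A`, `n`, standard `E` on `A.Z` and certified edge-data family on
`Sing(Ê)_cl`, the closure `Σ̄_max(Ê)` of the `Inv_max`-stratum of `ξ ↦ Inv_ξ(Ê)` (reduced structure) is REGULAR. Replaces the
role of nothing printed (director 2026-08-26T21:27:42Z (3): «open G3 residual of record … named binder for the D-lane»);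
CANDIDATE premise; NOT a statement of the manuscript. [folklore] -/
def CampaignW31HatClosureRegularI (p : ℕ) [Fact p.Prime] : Prop :=
  ∀ (K : Type u) [Field K] [CharP K p] [PerfectField K] (A : AmbientDatum p K) (n : ℕ),
    HatClosureRegular CampaignW31.edgeDataProvenance A n

/-- **[OURS · L1 W3.1] `CampaignW31HatOrdPowCutI p`** — `p`-slice of the weaker door `CampaignW31.HatOrdPowCut` at row 005
part b's provenance: SOME closed `C` with `OrdPowAlong C` cuts the `Inv_max`-stratum of `ξ ↦ Inv_ξ(Ê)` out of `Sing(Ê)_cl`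
inside its closure, for every standard `E` and certified family over perfect `K` of characteristic `p`. Replaces the role of
nothing printed; CANDIDATE premise; NOT a statement of the manuscript. [folklore] -/
def CampaignW31HatOrdPowCutI (p : ℕ) [Fact p.Prime] : Prop :=
  ∀ (K : Type u) [Field K] [CharP K p] [PerfectField K] (A : AmbientDatum p K) (n : ℕ),
    HatOrdPowCut CampaignW31.edgeDataProvenance A n

/-- **[OURS · L1 W3.1] `CampaignW31InvmaxClosureRegularI p` — the regularity half in the slot's ONE-EXPONENT idiom**:
for every perfect `K` of characteristic `p`, ambient datum `A`, `n`, STANDARD ideal exponent `E` on `A.Z` and every W3.1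
selection `sel` of Def. 4.9 edge data on `Sing(E)_cl` (`CampaignW31.EdgeDataSelection p n E CampaignW31.edgeDataProvenance`),
the closure of the `Inv_max`-stratum of `ξ ↦ Inv_ξ(E)` (reduced structure) is REGULAR
(`CampaignW31.InvmaxClosureRegularOn`). Stated for every standard `E` (as the slot statement is), hence it implies the
`Hat` slice at every `Ê` with `0 < Ê.b` (`campaignW31HatClosureRegularI_of_oneExponentI`). Replaces the role of nothing
printed; CANDIDATE premise (see the module docstring's warning); NOT a statement of the manuscript. [folklore] -/
def CampaignW31InvmaxClosureRegularI (p : ℕ) [Fact p.Prime] : Prop :=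
  ∀ (K : Type u) [Field K] [CharP K p] [PerfectField K] (A : AmbientDatum p K) (n : ℕ)
    (E : IdealExponent A.Z), E.IsStandard →
      ∀ sel : EdgeDataSelection p n E CampaignW31.edgeDataProvenance,
        InvmaxClosureRegularOn (E.sing ∩ S02Preliminaries.closedPoints A.Z) (selInv sel)

/-- Pure logic: the one-exponent regularity statement gives the `Hat` slice at every `Ê` with `0 < Ê.b` (the guard of
`U30_2_R2_inst`); selection `EdgeDataSelection.ofFamily`, value functions identified by `selInv_eq_invField`. [folklore] -/
theorem campaignW31HatClosureRegularI_of_oneExponentI (p : ℕ) [Fact p.Prime]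
    (h : CampaignW31InvmaxClosureRegularI.{u} p)
    (K : Type u) [Field K] [CharP K p] [PerfectField K] (A : AmbientDatum p K) (n : ℕ)
    (E : IdealExponent A.Z) (ed : EdgeDataOn p n (baseHike E)) (hE : E.IsStandard) (hb : 0 < (baseHike E).b)
    (hed : IsEdgeDataOn CampaignW31.edgeDataProvenance (baseHike E) ed) :
    InvmaxClosureRegularOn ((baseHike E).sing ∩ S02Preliminaries.closedPoints A.Z) (invField (baseHike E) ed) := by
  have h' := h K A n (baseHike E) (isStandard_baseHike hE hb) (EdgeDataSelection.ofFamily ed hed)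
  rwa [selInv_eq_invField, EdgeDataSelection.ofFamily_D] at h'

/-- Pure logic: the closedness half, `p`-slice, from the slot file's `CampaignW31InvmaxClosedI p`, at every `Ê` with `0 < Ê.b`. [folklore] -/
theorem campaignW31HatStratumClosedI_of_invmaxClosedI (p : ℕ) [Fact p.Prime] (h : CampaignW31InvmaxClosedI.{u} p)
    (K : Type u) [Field K] [CharP K p] [PerfectField K] (A : AmbientDatum p K) (n : ℕ)
    (E : IdealExponent A.Z) (ed : EdgeDataOn p n (baseHike E)) (hE : E.IsStandard) (hb : 0 < (baseHike E).b)
    (hed : IsEdgeDataOn CampaignW31.edgeDataProvenance (baseHike E) ed) :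
    StratumRelClosedOn ((baseHike E).sing ∩ S02Preliminaries.closedPoints A.Z) (invField (baseHike E) ed) := by
  have h' := (h K A n (baseHike E) (isStandard_baseHike hE hb) (EdgeDataSelection.ofFamily ed hed)).2
  rwa [invmaxStratumClosed_iff, selInv_eq_invField, EdgeDataSelection.ofFamily_D] at h'

end Summit.ResolutionOfSingularities.ResolutionOfSingularities.Theorems

end
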